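import Mathlib
import HarnessLib
import Summits.HubbardSuperconductivity.HubbardSuperconductivity.Theorems.KLProgrammeH10TwoPointLimitKlAnisoAnchoredSectorCountWindow
import Summits.HubbardSuperconductivity.HubbardSuperconductivity.Theorems.KLProgrammeH10TwoPointLimitPerturbedOneAnchoredSectorCountThin

/-!
# Route `KLProgramme` — K3 engine child `KLRegimeEngineV17F2` (stmt-HubbardSuperconductivity-20437), stub (b) import `ι₁` (two legs, floor units):
# THE ONE-ANCHORED COUNT OF THE ENGINE'S TWO-LEG ANISOTROPIC SECTOR CONSTRAINT SET `bgmSectorSet (klAnisoFamily … n) 2` — an ABSOLUTE constant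

Cell gate-hubbard-kl, seat hubbard-kl-k3c2-p3 (g15), row «sector-counting import», located «(ℓ)-IMPORT-ι₁-FLOOR» (KL STATUS 2026-08-29).  With the label of at least
ONE of the two legs prescribed (`Ω|_E = τ|_E`, `|E| ≥ 1`), the number of label tuples `Ω ∈ bgmSectorSet L M (klAnisoFamily L M β μ K e₀ n) 2` is `≤ C` — `C` uniform in
the frame (`FrameOK`, KL regime), `β, U, c, L, M`, the scale `n`, the anchored leg and its label.  This IS the one-anchor two-leg count that the two-leg floor import needs
(…EngineThinCount2Doors; the floor unit at two legs is `ε·4^{−J}` on every track, so no level gain is asked — only k-uniformity of the count).  The reduction is p4's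
(…KlAnisoAnchoredSectorCountThin §1–§3: torus ⇒ square with a reciprocal vector, here `|G_j| ≤ 1`; smooth label ⇒ sharp index among six residues; support ⇒ thin
frame shell), run on `oneAnchoredSectorCount_thin_frameOK` (…PerturbedOneAnchoredSectorCountThin): `6²·9` pieces, each injecting up to the `4` spins/charges of
the free leg into the admissible second sharp indices (legs permuted so that `σ 0` is anchored) — the two-leg twin of …KlAnisoFiveAnchoredSectorCount (p689490).

* `abs_le_one_of_sum_eq`, `exists_perm_one_mem`; **`card_bgmSectorSet_klAniso_oneAnchored_le`** (window `[μ₁, μ₂]`),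
  **`card_bgmSectorSet_klAniso_oneAnchored_le_window`** (`klWindowC`).

Everything is PROVED; no definitions, no named facts.  References: BGM 2006 §2.5 (2.45)–(2.48), §2.8 (2.73), (2.76)–(2.80), (2.96)–(2.98), Lemma 2.5, App. A3
[cite: BenfattoGiulianiMastropietro2006]; Mastropietro 2008 (14.67) p. 223 [cite: Mastropietro2008].
-/

noncomputable section

namespace Summit.HubbardSuperconductivity.HubbardSuperconductivity.Theorems.PerturbedFermiCurve

set_option linter.dupNamespace false -- summit = problem name (single-conjunct summit), D-0017

open Classical
open Real Set Finset
open Literature.MathematicalPhysics.QuantumLattice Literature.MathematicalPhysics.QuantumLattice.BandSectorCounting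
open Literature.Probability.LatticeModels
open Summit.HubbardSuperconductivity.HubbardSuperconductivity.Theorems.DispersionFlow
open Summit.HubbardSuperconductivity.HubbardSuperconductivity.Theorems.KLRegimeSplit
open Summit.HubbardSuperconductivity.HubbardSuperconductivity.Theorems.KLProgrammeLegKernels

/-- A reciprocal vector `2πG` reached by two momenta of the closed square has `|G_j| ≤ 1`. [folklore] -/
theorem abs_le_one_of_sum_eq {q : Fin 2 → Fin 2 → ℝ} (hq : ∀ i j, |q i j| ≤ π) {G : Fin 2 → ℤ}
    (hG : ∀ j, ∑ i, q i j = 2 * π * (G j : ℝ)) (j : Fin 2) : |G j| ≤ 1 := by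
  have h1 : |∑ i, q i j| ≤ 2 * π := by
    refine (Finset.abs_sum_le_sum_abs _ _).trans ?_
    calc ∑ i, |q i j| ≤ ∑ _i : Fin 2, π := Finset.sum_le_sum fun i _ => hq i j
      _ = 2 * π := by simp
  rw [hG j, abs_mul, abs_of_pos Real.two_pi_pos] at h1
  have h2 : |(G j : ℝ)| ≤ 1 := by nlinarith [Real.pi_pos, abs_nonneg (G j : ℝ)]
  exact_mod_cast h2

/-- A nonempty set of the two legs contains the image of `0` under some permutation of the legs. [folklore] -/
theorem exists_perm_one_mem (E : Finset (Fin 2)) (hE : 1 ≤ E.card) : ∃ σ : Equiv.Perm (Fin 2), ∀ j : Fin 2, j ≠ 1 → σ j ∈ E := by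
  by_cases hall : ∀ i, i ∈ E
  · exact ⟨1, fun j _ => hall _⟩
  · obtain ⟨q, hq⟩ := not_forall.1 hall
    have hc : Eᶜ.card ≤ 1 := by rw [Finset.card_compl, Fintype.card_fin]; omega
    refine ⟨Equiv.swap 1 q, fun j hj => ?_⟩
    by_contra hjE
    have hmem : Equiv.swap 1 q j ∈ Eᶜ := Finset.mem_compl.2 hjE
    have hqc : q ∈ Eᶜ := Finset.mem_compl.2 hq
    have heq : Equiv.swap 1 q j = q := Finset.card_le_one.1 hc _ hmem _ hqc
    have : j = 1 := by
      have h2 := congrArg (Equiv.swap 1 q) heq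
      rw [Equiv.swap_apply_self, Equiv.swap_apply_right] at h2
      exact h2
    exact hj this

/-- **THE ONE-ANCHORED COUNT OF THE ENGINE'S TWO-LEG ANISOTROPIC SECTOR CONSTRAINT SET.**  For every level window `[μ₁, μ₂] ⊂ (-4, 0)` there is `C` (geometric: fixed
BEFORE `R`), and for every `R` thresholds `c₃, U₀ > 0`, such that for all `0 < c ≤ c₃`, `0 < U ≤ U₀`, `klBetaMin ≤ β ≤ e^{c/U²}`, `μ ∈ [μ₁, μ₂]`, every frame with
`FrameOK R U (nScales β) ν K`, every torus `L ≥ 1`, cutoff `M`, scale `n`, every nonempty set `E` of the two legs and prescribed labels `τ`: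
`#{Ω ∈ bgmSectorSet L M (klAnisoFamily L M β μ K klE0 n) 2 : ∀ e ∈ E, Ω e = τ e} ≤ C` — an ABSOLUTE constant, no `sectorCount n`, no `|h| = n` factor
(two legs: momentum conservation alone fixes the second sector up to an absolute number of neighbours).
[cite: BenfattoGiulianiMastropietro2006, §2.8 (2.73), (2.76)–(2.80), (2.96)–(2.98), Lemma 2.5, App. A3] -/
theorem card_bgmSectorSet_klAniso_oneAnchored_le :
    ∀ μ₁ μ₂ : ℝ, -4 < μ₁ → μ₁ ≤ μ₂ → μ₂ < 0 → ∃ C : ℝ, 0 < C ∧ ∀ R : RenConsts, (∀ j, 0 ≤ R.Gfr j) →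
      ∃ c₃ : ℝ, 0 < c₃ ∧ ∃ U₀ : ℝ, 0 < U₀ ∧
      ∀ c : ℝ, 0 < c → c ≤ c₃ → ∀ U : ℝ, 0 < U → U ≤ U₀ → ∀ β : ℝ, klBetaMin ≤ β → β ≤ Real.exp (c / U ^ 2) →
      ∀ μ ∈ Set.Icc μ₁ μ₂, ∀ (ν : ℝ) (K : TrigPolyC4v), FrameOK R U (nScales β) ν K →
      ∀ (L M : ℕ) [NeZero L] (n : ℕ) (E : Finset (Fin 2)), 1 ≤ E.card → ∀ τ : Fin 2 → SectorLeg (sectorCount n),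
      ((((bgmSectorSet L M (klAnisoFamily L M β μ K klE0 n) 2).filter
          (fun Ω : Fin 2 → SectorLeg (sectorCount n) => ∀ e ∈ E, Ω e = τ e)).card : ℕ) : ℝ) ≤ C := by
  intro μ₁ μ₂ hμ₁ h12 hμ₂
  have he0 : (0 : ℝ) < klE0 := by norm_num [klE0]
  obtain ⟨Kc, hKc, hKR⟩ := oneAnchoredSectorCount_thin_frameOK μ₁ μ₂ (klE0 / π ^ 2) hμ₁ h12 hμ₂ (by positivity)
  refine ⟨324 * 4 * Kc, by positivity, fun R hR => ?_⟩
  obtain ⟨c₃, hc₃, U₀, hU₀, hcount⟩ := hKR R hR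
  refine ⟨c₃, hc₃, U₀, hU₀, ?_⟩
  intro c hc hcle U hU hUle β hβmin hβc μ hμ ν K hK L M _ n E hE τ
  have hC := hcount c hc hcle U hU hUle β hβmin hβc μ hμ ν K hK n
  have hNpos : 0 < sectorCount n := sectorCount_pos n
  -- a permutation `σ` of the legs with `σ 0` anchored
  obtain ⟨σ, hσE⟩ := exists_perm_one_mem E hE
  have hc5 : ∀ i : Fin 1, Fin.castSucc i ≠ (1 : Fin 2) := by decide
  have hσσ : ∀ i, σ (σ.symm i) = i := fun i => σ.apply_symm_apply i
  -- the six candidate sharp indices of a label: `(ω + e·2ⁿ + d + N − 1) mod N`, `(e, d) ∈ Fin 2 × Fin 3`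
  obtain ⟨sh, hshdef⟩ : ∃ sh : Fin 2 × Fin 3 → SectorLeg (sectorCount n) → Fin (sectorCount n),
      ∀ ed lam, (sh ed lam : ℕ) = ((lam.1.1 : ℕ) + (ed.1 : ℕ) * 2 ^ n + (ed.2 : ℕ) + (sectorCount n - 1)) % sectorCount n :=
    ⟨fun ed lam => ⟨((lam.1.1 : ℕ) + (ed.1 : ℕ) * 2 ^ n + (ed.2 : ℕ) + (sectorCount n - 1)) % sectorCount n,
      Nat.mod_lt _ hNpos⟩, fun _ _ => rfl⟩
  have hsh_inj : ∀ (ed : Fin 2 × Fin 3) (lam lam' : SectorLeg (sectorCount n)), sh ed lam = sh ed lam' →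
      lam.1.2 = lam'.1.2 → lam.2 = lam'.2 → lam = lam' := by
    intro ed lam lam' h1 h2 h3
    have h1' : ((lam.1.1 : ℕ) + ((ed.1 : ℕ) * 2 ^ n + (ed.2 : ℕ) + (sectorCount n - 1))) % sectorCount n =
        ((lam'.1.1 : ℕ) + ((ed.1 : ℕ) * 2 ^ n + (ed.2 : ℕ) + (sectorCount n - 1))) % sectorCount n := by
      have := congrArg Fin.val h1
      rw [hshdef, hshdef] at this
      simpa only [add_assoc] using this
    have hmod : (lam.1.1 : ℕ) ≡ (lam'.1.1 : ℕ) [MOD sectorCount n] := Nat.ModEq.add_right_cancel' _ h1'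
    have heq : (lam.1.1 : ℕ) = (lam'.1.1 : ℕ) := Nat.ModEq.eq_of_lt_of_lt hmod lam.1.1.isLt lam'.1.1.isLt
    exact Prod.ext (Prod.ext (Fin.ext heq) h2) h3
  -- the admissible second sharp indices of the frame count (anchor `ωa`, reciprocal vector `G`)
  obtain ⟨Adm, hAdmdef⟩ : ∃ Adm : (Fin 1 → Fin (sectorCount n)) → (Fin 2 → ℤ) →
      Finset (Fin (sectorCount n)), ∀ ωa G, Adm ωa G =
    (Finset.univ : Finset (Fin (sectorCount n))).filter (fun ω₂ : Fin (sectorCount n) =>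
      ∃ k : Fin 2 → Fin 2 → ℝ, (∀ j i, |k j i| ≤ Real.pi) ∧
        (∀ j, |frameLevel μ K (WithLp.toLp 2 (k j))| ≤ klE0 / π ^ 2 * sectorWidth n ^ 2) ∧
        (∀ j : Fin 1, sectorIndex n (Complex.arg (⟨k (Fin.castSucc j) 0, k (Fin.castSucc j) 1⟩ : ℂ)) = (ωa j : ℕ)) ∧
        sectorIndex n (Complex.arg (⟨k 1 0, k 1 1⟩ : ℂ)) = (ω₂ : ℕ) ∧
        (∀ i, ∑ j, k j i = 2 * Real.pi * (G i : ℝ))) := ⟨_, fun _ _ => rfl⟩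
  have hAdm : ∀ ωa G, ((Adm ωa G).card : ℝ) ≤ Kc := fun ωa G => by rw [hAdmdef]; exact hC G ωa
  -- reciprocal vectors `|G_j| ≤ 1`, parametrised by `Fin 3 × Fin 3`
  obtain ⟨Gof, hGofdef⟩ : ∃ Gof : Fin 3 × Fin 3 → Fin 2 → ℤ, ∀ g i,
      Gof g i = if i = 0 then ((g.1 : ℕ) : ℤ) - 1 else ((g.2 : ℕ) : ℤ) - 1 := ⟨fun g i => _, fun _ _ => rfl⟩
  -- the pieces
  obtain ⟨S, hSdef⟩ : ∃ S : (Fin 2 → Fin 2 × Fin 3) × (Fin 3 × Fin 3) → Finset (Fin 2 → SectorLeg (sectorCount n)),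
      ∀ par, S par = (Finset.univ : Finset (Fin 2 → SectorLeg (sectorCount n))).filter
        (fun Ω : Fin 2 → SectorLeg (sectorCount n) => (∀ e ∈ E, Ω e = τ e) ∧
        sh (par.1 (σ 1)) (Ω (σ 1)) ∈
          Adm (fun i : Fin 1 => sh (par.1 (σ (Fin.castSucc i))) (τ (σ (Fin.castSucc i)))) (Gof par.2)) :=
    ⟨_, fun _ => rfl⟩
  -- (1) COVER: every admissible `Ω` lies in a piece
  have hcover : (bgmSectorSet L M (klAnisoFamily L M β μ K klE0 n) 2).filter
      (fun Ω : Fin 2 → SectorLeg (sectorCount n) => ∀ e ∈ E, Ω e = τ e) ⊆ Finset.univ.biUnion S := by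
    intro Ω hΩ
    simp only [Finset.mem_biUnion, Finset.mem_univ, true_and]
    rw [Finset.mem_filter, mem_bgmSectorSet] at hΩ
    have hΩE : ∀ e ∈ E, Ω e = τ e := hΩ.2
    obtain ⟨kf, hkF, hsum⟩ := hΩ.1
    -- signed centred momenta of the legs
    obtain ⟨q, hqdef⟩ : ∃ q : Fin 2 → Fin 2 → ℝ, ∀ i j, q i j =
        if (Ω i).2 = 0 then torusCentredMomentum L (kf i).2 j else -torusCentredMomentum L (kf i).2 j :=
      ⟨_, fun _ _ => rfl⟩
    have hqfun : ∀ i, q i = fun j =>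
        if (Ω i).2 = 0 then torusCentredMomentum L (kf i).2 j else -torusCentredMomentum L (kf i).2 j :=
      fun i => funext (hqdef i)
    have hqabs : ∀ i j, |q i j| ≤ π := fun i j => by
      rw [hqdef]; exact abs_signed_torusCentredMomentum_le_pi L (Ω i).2 (kf i).2 j
    have hqlev : ∀ i, |frameLevel μ K (WithLp.toLp 2 (q i))| ≤ klE0 / π ^ 2 * sectorWidth n ^ 2 := fun i => by
      rw [hqfun]; exact leg_thin_shell L M (hkF i) (Ω i).2
    have hqidx : ∀ i, ∃ ed : Fin 2 × Fin 3, sectorIndex n (Complex.arg (⟨q i 0, q i 1⟩ : ℂ)) = (sh ed (Ω i) : ℕ) := by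
      intro i
      obtain ⟨e, d, hed⟩ := leg_sharp_index L M (hkF i) (Ω i).2
      refine ⟨(e, d), ?_⟩
      rw [hshdef, hqdef, hqdef]
      exact hed
    choose ed hed using hqidx
    obtain ⟨G, hG⟩ := exists_sum_signed_torusCentredMomentum_eq L (fun i => (Ω i).2) (fun i => (kf i).2) hsum
    have hGq : ∀ j, ∑ i, q i j = 2 * π * (G j : ℝ) := fun j => by
      rw [← hG j]
      exact Finset.sum_congr rfl fun i _ => hqdef i j
    have hGabs : ∀ j, |G j| ≤ 1 := abs_le_one_of_sum_eq hqabs hGq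
    have hG0 := hGabs 0
    have hG1 := hGabs 1
    rw [abs_le] at hG0 hG1
    -- the parameters of the piece
    obtain ⟨g, hg⟩ : ∃ g : Fin 3 × Fin 3, Gof g = G := by
      refine ⟨(⟨(G 0 + 1).toNat, by omega⟩, ⟨(G 1 + 1).toNat, by omega⟩), funext fun i => ?_⟩
      have e0 : (((G 0 + 1).toNat : ℕ) : ℤ) = G 0 + 1 := Int.toNat_of_nonneg (by omega)
      have e1 : (((G 1 + 1).toNat : ℕ) : ℤ) = G 1 + 1 := Int.toNat_of_nonneg (by omega)
      rw [hGofdef]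
      split_ifs with hi
      · rw [hi]
        simp only [e0]
        ring
      · have hi1 : i = 1 := by fin_cases i <;> first | rfl | exact absurd rfl hi
        rw [hi1]
        simp only [e1]
        ring
    refine ⟨(ed, g), ?_⟩
    rw [hSdef, Finset.mem_filter]
    refine ⟨Finset.mem_univ _, hΩE, ?_⟩
    rw [hg, hAdmdef, Finset.mem_filter]
    refine ⟨Finset.mem_univ _, fun j => q (σ j), fun j i => hqabs _ _, fun j => hqlev _, fun j => ?_, hed (σ 1), fun i => ?_⟩
    · show sectorIndex n (Complex.arg (⟨q (σ (Fin.castSucc j)) 0, q (σ (Fin.castSucc j)) 1⟩ : ℂ)) =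
        (sh (ed (σ (Fin.castSucc j))) (τ (σ (Fin.castSucc j))) : ℕ)
      rw [← hΩE (σ (Fin.castSucc j)) (hσE _ (hc5 j))]
      exact hed (σ (Fin.castSucc j))
    · exact (Equiv.sum_comp σ (fun j => q j i)).trans (hGq i)
  -- (2) PIECES: each piece injects, up to the `4` spin/charge choices of the free leg, into the admissible second sharp indices
  have hpiece : ∀ par : (Fin 2 → Fin 2 × Fin 3) × (Fin 3 × Fin 3), ((S par).card : ℝ) ≤ 4 * Kc := by
    intro par
    obtain ⟨f, hfdef⟩ : ∃ f : (Fin 2 → SectorLeg (sectorCount n)) → Fin (sectorCount n),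
        ∀ Ω, f Ω = sh (par.1 (σ 1)) (Ω (σ 1)) := ⟨_, fun _ => rfl⟩
    have hmaps : ∀ Ω ∈ S par, f Ω ∈ Adm (fun i : Fin 1 => sh (par.1 (σ (Fin.castSucc i))) (τ (σ (Fin.castSucc i)))) (Gof par.2) := by
      intro Ω hΩ
      rw [hSdef, Finset.mem_filter] at hΩ
      rw [hfdef]
      exact hΩ.2.2
    have hfib : ∀ b ∈ Adm (fun i : Fin 1 => sh (par.1 (σ (Fin.castSucc i))) (τ (σ (Fin.castSucc i)))) (Gof par.2),
        ((S par).filter (fun Ω => f Ω = b)).card ≤ 4 := by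
      intro b _
      obtain ⟨sc, hscdef⟩ : ∃ sc : (Fin 2 → SectorLeg (sectorCount n)) → Fin 2 × Fin 2,
          ∀ Ω, sc Ω = ((Ω (σ 1)).1.2, (Ω (σ 1)).2) := ⟨_, fun _ => rfl⟩
      have hinj : Set.InjOn sc ↑((S par).filter (fun Ω => f Ω = b)) := by
        intro Ω hΩ Ω' hΩ' hsc
        rw [Finset.coe_filter, Set.mem_setOf_eq] at hΩ hΩ'
        have hΩS := hΩ.1
        have hΩ'S := hΩ'.1
        rw [hSdef, Finset.mem_filter] at hΩS hΩ'S
        have hff : f Ω = f Ω' := hΩ.2.trans hΩ'.2.symm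
        rw [hfdef, hfdef] at hff
        rw [hscdef, hscdef, Prod.mk.injEq] at hsc
        have h4 : ∀ m : Fin 2, Ω (σ m) = Ω' (σ m) := by
          intro m
          by_cases hm : m = 1
          · rw [hm]; exact hsh_inj _ _ _ hff hsc.1 hsc.2
          · rw [hΩS.2.1 (σ m) (hσE m hm), hΩ'S.2.1 (σ m) (hσE m hm)]
        funext i
        rw [← hσσ i]
        exact h4 (σ.symm i)
      calc ((S par).filter (fun Ω => f Ω = b)).card
          ≤ (Finset.univ : Finset (Fin 2 × Fin 2)).card :=
            Finset.card_le_card_of_injOn sc (fun _ _ => Finset.mem_coe.2 (Finset.mem_univ _)) hinj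
        _ = 4 := by simp
    have hle := Finset.card_le_mul_card_image_of_maps_to hmaps 4 hfib
    calc ((S par).card : ℝ) ≤ ((4 * (Adm (fun i : Fin 1 => sh (par.1 (σ (Fin.castSucc i))) (τ (σ (Fin.castSucc i))))
        (Gof par.2)).card : ℕ) : ℝ) := by exact_mod_cast hle
      _ = 4 * ((Adm (fun i : Fin 1 => sh (par.1 (σ (Fin.castSucc i))) (τ (σ (Fin.castSucc i)))) (Gof par.2)).card : ℝ) := by
          push_cast; ring
      _ ≤ 4 * Kc := mul_le_mul_of_nonneg_left (hAdm _ _) (by norm_num)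
  -- (3) ASSEMBLY
  calc _ ≤ ((Finset.univ.biUnion S).card : ℝ) := by exact_mod_cast Finset.card_le_card hcover
    _ ≤ ∑ par, ((S par).card : ℝ) := by exact_mod_cast Finset.card_biUnion_le
    _ ≤ ∑ _par : (Fin 2 → Fin 2 × Fin 3) × (Fin 3 × Fin 3), 4 * Kc := Finset.sum_le_sum fun par _ => hpiece par
    _ = 324 * 4 * Kc := by
        simp only [Finset.sum_const, Finset.card_univ, Fintype.card_prod, Fintype.card_fun, Fintype.card_fin, nsmul_eq_mul]
        norm_num
        ring

/-- **The one-anchored two-leg count on the covariance window `klWindowC`**: there is `C > 0` and, for every `R` with `0 ≤ R.Gfr j`, thresholds `c₃, U₀ > 0` such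
that for all `0 < c ≤ c₃`, `0 < U ≤ U₀`, `klBetaMin ≤ β ≤ e^{c/U²}`, `μ ∈ klWindowC`, every frame with `FrameOK R U (nScales β) ν K`, every `L ≥ 1`, `M`,
scale `n`, nonempty set `E` of the two legs and labels `τ`: `#{Ω ∈ bgmSectorSet L M (klAnisoFamily L M β μ K klE0 n) 2 : Ω|_E = τ|_E} ≤ C`.
[cite: BenfattoGiulianiMastropietro2006, §2.8 (2.73), (2.76)–(2.80), (2.96)–(2.98), Lemma 2.5, App. A3] -/
theorem card_bgmSectorSet_klAniso_oneAnchored_le_window :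
    ∃ C : ℝ, 0 < C ∧ ∀ R : RenConsts, (∀ j, 0 ≤ R.Gfr j) →
      ∃ c₃ : ℝ, 0 < c₃ ∧ ∃ U₀ : ℝ, 0 < U₀ ∧
      ∀ c : ℝ, 0 < c → c ≤ c₃ → ∀ U : ℝ, 0 < U → U ≤ U₀ → ∀ β : ℝ, klBetaMin ≤ β → β ≤ Real.exp (c / U ^ 2) →
      ∀ μ ∈ klWindowC, ∀ (ν : ℝ) (K : TrigPolyC4v), FrameOK R U (nScales β) ν K →
      ∀ (L M : ℕ) [NeZero L] (n : ℕ) (E : Finset (Fin 2)), 1 ≤ E.card → ∀ τ : Fin 2 → SectorLeg (sectorCount n),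
      ((((bgmSectorSet L M (klAnisoFamily L M β μ K klE0 n) 2).filter
          (fun Ω : Fin 2 → SectorLeg (sectorCount n) => ∀ e ∈ E, Ω e = τ e)).card : ℕ) : ℝ) ≤ C :=
  card_bgmSectorSet_klAniso_oneAnchored_le (-1.05) (-0.15) (by norm_num) (by norm_num) (by norm_num)

end Summit.HubbardSuperconductivity.HubbardSuperconductivity.Theorems.PerturbedFermiCurve

end
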